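import Summits.QuantumFields.YangMills.Theorems.FemtoCutoffLadderThinningDefs
import Summits.QuantumFields.YangMills.Theorems.FemtoTransferGap
import Literature.MathematicalPhysics.QuantumFieldTheory.StrongCouplingActivities

/-!
# Route `FemtoCutoffLadder` — the THINNING map between spatial tori of sizes `L' ≤ L ≤ 2L'`: gauge and twist covariance,
# `thin_* (∏ Haar) = ∏ Haar`, and the pull-back of physical zero-flux test functions (kinematics of the upward incommensurable step of
# crux `SubOctaveBounded`, stmt-QuantumFields-24085, and of its nested-upper children)

Seat `ym-line-fcl-p3` (2026-08-28).  Definitions: `FemtoCutoffLadderThinningDefs.lean` (`thinCoord`, `thinSteps`, `thinSite`, `thin`, `thinLift`).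
For `L' ≤ L ≤ 2L'` (NO divisibility) the coarse coordinate `a` sits at the fine coordinate `ι(a) = a + min(a, L − L')`, consecutive coarse sites are
`thinSteps a ∈ {1, 2}` fine steps apart (cyclically: `ι(L'−1) + thinSteps(L'−1) = L`), and the coarse link `(x', i)` is the ordered product of
those fine links (`thin`).  Proved here:

* §0–§1 `thin_apply`, continuity/measurability, the arithmetic of `ι` (`thinCoord_add_one`: `ι(a+1) = ι(a) + thinSteps a` in `ℤ/L`;
  `thinSite_shift`: `ι(x' + eᵢ)` is the end of the straight fine path; injectivity; the middle site of a two-link path is not in the image).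
* §2 ★ `thin_gaugeTransform : thin (U^g) = (thin U)^{g ∘ ι}` and ★ `thin_twist : thin (twist_k^z U) = twist_k^z (thin U)` (every `z`).
* §3 ★★ `map_thin_configMeasure : (configMeasure G L).map (thin L') = configMeasure G L'` — the image is a left-invariant probability measure on
  the compact group `G^{E'}` (left translations lift through `thinLift`: `thin (thinLift W · U) = W · thin U`), hence THE Haar probability
  measure (Mathlib `isMulLeftInvariant_eq_smul`); `measurePreserving_thin`, `integral_comp_thin`, ★ `l2_comp_thin` (the pull-back is an
  `L²` isometry).
* §4 ★ `isPhys_comp_thin : IsPhys ψ → IsPhys (ψ ∘ thin L')` — pull-backs of coarse physical zero-flux test functions are fine physical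
  zero-flux test functions.

USE (why this is here): the upward step «fine below coarse» `z̃(Λ, L) ≤ z̃(Λ, L') + CΛ²` for `L' < L < 2L'` (certificate
`CutoffLadder.femtoGapOfRecord_of_towerLadder_up`) is variational — a LOWER bound on `λ₁(L)/λ₀(L)` over physical time `1` from ONE fine trial
function; the natural one is the coarse first excitation (ground-state representation) pulled back along `thin`, which by this module is
physical, correctly normalised, and sees the coarse twists/gauge group.  What is NOT here: any comparison of the fine and coarse DYNAMICS on
such pull-backs (that is the two-cutoff content of the step; barrier `UVStabilityNonUniqueness`).  R2b1 is a RECORD rung; no step and no summit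
is proved by this module.  No new definitions, no named facts, no `sorry`.
-/

set_option autoImplicit false


noncomputable section

namespace Summit.QuantumFields.YangMills.Theorems.FemtoCutoffLadder.Thinning

open MeasureTheory
open Literature.MathematicalPhysics.QuantumFieldTheory
open Literature.MathematicalPhysics.QuantumLattice (transport transport_cons transport_nil pathEnd pathEnd_cons pathEnd_nil
  transport_gaugeTransform)
open Summit.QuantumFields.YangMills.Theorems.FemtoTransferGap

/-! ## §0 Generic facts (no size hypotheses) -/

/-- The straight path of `n` steps in direction `i` ends at `c + n·eᵢ`. [folklore] -/
theorem pathEnd_replicate {d M : ℕ} (c : Site d M) (i : Fin d) (n : ℕ) :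
    pathEnd c (List.replicate n i) = c + Pi.single i ((n : ℕ) : ZMod M) := by
  induction n generalizing c with
  | zero => simp
  | succ n ih =>
    rw [List.replicate_succ, pathEnd_cons, ih]
    simp only [Site.shift, add_assoc, ← Pi.single_add, Nat.cast_succ, add_comm (1 : ZMod M)]

/-- Unfolding of one coarse link: one fine link, or the ordered product of two. [folklore] -/
theorem thin_apply {d L L' : ℕ} {M : Type*} [Monoid M] (U : GaugeConfig d L M) (x' : Site d L') (i : Fin d) :
    thin L' U (x', i) = if (x' i).val < L - L' then
      U (thinSite L x', i) * U ((thinSite L x').shift i, i) else U (thinSite L x', i) := by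
  simp only [thin, thinSteps]
  split_ifs
  · simp [List.replicate, transport_cons, transport_nil]
  · simp [List.replicate, transport_cons, transport_nil]

section Measurability

variable {d L L' : ℕ} {G : Type*} [Monoid G] [TopologicalSpace G] [ContinuousMul G]

/-- The transporter along a fixed path depends continuously on the configuration. [folklore] -/
theorem continuous_transport (c : Site d L) (is : List (Fin d)) :
    Continuous fun U : GaugeConfig d L G => transport U c is := by
  induction is generalizing c with
  | nil => simp only [transport_nil]; exact continuous_const
  | cons i is ih => simp only [transport_cons]; exact (continuous_apply _).mul (ih _)

variable (L') in
/-- Thinning is continuous. [folklore] -/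
theorem continuous_thin : Continuous (thin L' : GaugeConfig d L G → GaugeConfig d L' G) :=
  continuous_pi fun e' => continuous_transport (thinSite L e'.1) _

variable (L') in
/-- Thinning is measurable (Borel structures). [folklore] -/
theorem measurable_thin [NeZero L] [NeZero L'] [MeasurableSpace G] [BorelSpace G] [SecondCountableTopology G] :
    Measurable (thin L' : GaugeConfig d L G → GaugeConfig d L' G) :=
  (continuous_thin L').measurable

end Measurability

/-! ## §1 Arithmetic of the coordinate embedding (`L' ≤ L ≤ 2L'`) -/

section Arithmetic

variable {L L' : ℕ} [NeZero L']

/-- Representative of `ι(a)`: `ι(a) = a + min(a, L − L') < L`. [folklore] -/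
theorem thinCoord_val (hLL : L' ≤ L) (a : ZMod L') : (thinCoord L L' a).val = a.val + min a.val (L - L') := by
  have ha : a.val < L' := ZMod.val_lt a
  unfold thinCoord
  exact ZMod.val_natCast_of_lt (by omega)

/-- `ι` is injective. [folklore] -/
theorem thinCoord_injective (hLL : L' ≤ L) : Function.Injective (thinCoord L L') := by
  intro a b hab
  have h := congrArg ZMod.val hab
  rw [thinCoord_val hLL, thinCoord_val hLL] at h
  exact ZMod.val_injective L' (by omega)

/-- `thinSite` is injective. [folklore] -/
theorem thinSite_injective (hLL : L' ≤ L) {d : ℕ} : Function.Injective (thinSite L (d := d) (L' := L')) := by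
  intro x y hxy
  funext j
  exact thinCoord_injective hLL (congrFun hxy j)

/-- `ι(a) = 0 ↔ a = 0`. [folklore] -/
theorem thinCoord_eq_zero_iff (hLL : L' ≤ L) (a : ZMod L') : thinCoord L L' a = 0 ↔ a = 0 := by
  rw [← ZMod.val_eq_zero, thinCoord_val hLL, ← ZMod.val_eq_zero]
  omega

/-- **Cyclic consistency**: `ι(a + 1) = ι(a) + thinSteps(a)` in `ℤ/L`, including the wrap-around
`ι(L' − 1) + thinSteps(L' − 1) = L ≡ 0 = ι(0)`. [folklore] -/
theorem thinCoord_add_one (hLL : L' ≤ L) (h2 : L ≤ 2 * L') (a : ZMod L') :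
    thinCoord L L' (a + 1) = thinCoord L L' a + ((thinSteps L L' a : ℕ) : ZMod L) := by
  have ha : a.val < L' := ZMod.val_lt a
  unfold thinCoord thinSteps
  rw [← Nat.cast_add]
  by_cases hlt : a.val + 1 < L'
  · haveI : Fact (1 < L') := ⟨by omega⟩
    have hval : (a + 1).val = a.val + 1 := by
      rw [ZMod.val_add_of_lt (by rw [ZMod.val_one]; exact hlt), ZMod.val_one]
    rw [hval]
    congr 1
    split_ifs <;> omega
  · have hval : a.val + 1 = L' := by omega
    have ha0 : a + 1 = 0 := by
      have h1 : ((a.val + 1 : ℕ) : ZMod L') = a + 1 := by push_cast; rw [ZMod.natCast_zmod_val]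
      rw [← h1, hval, ZMod.natCast_self]
    rw [ha0, ZMod.val_zero]
    have hsum : a.val + min a.val (L - L') + (if a.val < L - L' then 2 else 1) = L := by
      split_ifs <;> omega
    rw [hsum, ZMod.natCast_self]
    simp

/-- **The embedding intertwines the coarse shift with the fine straight path**: `ι(x' + eᵢ)` is the endpoint of the path of
`thinSteps (x' i)` fine steps of direction `i` from `ι(x')`. [folklore] -/
theorem thinSite_shift (hLL : L' ≤ L) (h2 : L ≤ 2 * L') {d : ℕ} (x' : Site d L') (i : Fin d) :
    thinSite L (x'.shift i) = pathEnd (thinSite L x') (List.replicate (thinSteps L L' (x' i)) i) := by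
  rw [pathEnd_replicate]
  funext j
  simp only [thinSite, Site.shift, Pi.add_apply]
  by_cases hj : j = i
  · subst hj
    rw [Pi.single_eq_same, Pi.single_eq_same, thinCoord_add_one hLL h2]
  · rw [Pi.single_eq_of_ne hj, Pi.single_eq_of_ne hj, add_zero, add_zero]

/-- When a coarse link covers two fine links, the middle fine site `ι(a) + 1` is NOT in the image of `ι`. [folklore] -/
theorem thinCoord_add_one_not_mem_range (hLL : L' ≤ L) {a : ZMod L'} (ha : a.val < L - L') (b : ZMod L') :
    thinCoord L L' b ≠ thinCoord L L' a + 1 := by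
  intro hb
  have hav : a.val < L' := ZMod.val_lt a
  haveI : NeZero L := ⟨by omega⟩
  haveI : Fact (1 < L) := ⟨by omega⟩
  have hva : (thinCoord L L' a).val = 2 * a.val := by rw [thinCoord_val hLL]; omega
  have hbv : b.val < L' := ZMod.val_lt b
  have hv1 : (thinCoord L L' a + 1).val = 2 * a.val + 1 := by
    rw [ZMod.val_add_of_lt (by rw [ZMod.val_one, hva]; omega), ZMod.val_one, hva]
  have h := congrArg ZMod.val hb
  rw [hv1, thinCoord_val hLL] at h
  omega

/-- … hence in particular `ι(a) + 1 ≠ 0`. [folklore] -/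
theorem thinCoord_add_one_ne_zero (hLL : L' ≤ L) {a : ZMod L'} (ha : a.val < L - L') : thinCoord L L' a + 1 ≠ 0 := by
  intro h0
  have h := thinCoord_add_one_not_mem_range hLL ha 0
  rw [h0, (thinCoord_eq_zero_iff hLL 0).mpr rfl] at h
  exact h rfl

end Arithmetic

/-! ## §2 Gauge and twist covariance -/

section Covariance

variable {L L' : ℕ} [NeZero L'] {G : Type*} [Group G]

/-- **Gauge covariance of thinning**: `thin (U^g) = (thin U)^{g ∘ ι}` (telescoping of the ordered product along each straight path,
tree `transport_gaugeTransform`). [folklore] -/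
theorem thin_gaugeTransform (hLL : L' ≤ L) (h2 : L ≤ 2 * L') {d : ℕ} (g : Site d L → G) (U : GaugeConfig d L G) :
    thin L' (gaugeTransform g U) = gaugeTransform (fun x' => g (thinSite L x')) (thin L' U) := by
  funext e'
  obtain ⟨x', i⟩ := e'
  simp only [thin, gaugeTransform]
  rw [transport_gaugeTransform, ← thinSite_shift hLL h2]

/-- **Twist covariance of thinning** (`d = 3`): the centre twist through the fine plane `x_k = 0` is carried to the centre twist through
the coarse plane `x'_k = 0` — the twisted fine link of each `k`-line is the FIRST link of the path of the coarse link issuing from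
`x'_k = 0` (`ι(a) = 0 ↔ a = 0`, and a middle site `ι(a) + 1` is never `0`). Holds for every `z`, central or not. [cite: tHooft1979] -/
theorem thin_twist (hLL : L' ≤ L) (k : Fin 3) (z : G) (U : GaugeConfig 3 L G) :
    thin L' (twist k z U) = twist k z (thin L' U) := by
  funext e'
  obtain ⟨x', i⟩ := e'
  show thin L' (twist k z U) (x', i) = (if i = k ∧ x' k = 0 then z * thin L' U (x', i) else thin L' U (x', i))
  rw [thin_apply, thin_apply]
  by_cases hik : i = k
  · subst hik
    have hfirst : thinSite L x' i = 0 ↔ x' i = 0 := thinCoord_eq_zero_iff hLL (x' i)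
    by_cases hD : (x' i).val < L - L'
    · have hmid : ¬ ((thinSite L x').shift i) i = 0 := by
        simp only [Site.shift, Pi.add_apply, Pi.single_eq_same, thinSite]
        exact thinCoord_add_one_ne_zero hLL hD
      rw [if_pos hD, if_pos hD]
      simp only [twist, true_and, hmid, if_false]
      by_cases hx : x' i = 0
      · rw [if_pos (hfirst.mpr hx), if_pos hx, mul_assoc]
      · rw [if_neg (mt hfirst.mp hx), if_neg hx]
    · rw [if_neg hD, if_neg hD]
      simp only [twist, true_and]
      by_cases hx : x' i = 0
      · rw [if_pos (hfirst.mpr hx), if_pos hx]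
      · rw [if_neg (mt hfirst.mp hx), if_neg hx]
  · simp only [twist, hik, false_and, if_false]

end Covariance

/-! ## §3 Haar measure: thinning pushes the product Haar measure forward to the product Haar measure -/

section Lift

variable {L L' : ℕ} [NeZero L'] {G : Type*} [Group G]

/-- The lift sits on the first link of each path: `thinLift W (ι x', i) = W (x', i)`. [folklore] -/
theorem thinLift_apply_thinSite (hLL : L' ≤ L) {d : ℕ} (W : GaugeConfig d L' G) (x' : Site d L') (i : Fin d) :
    thinLift L W (thinSite L x', i) = W (x', i) := by
  have h : ∃ y' : Site d L', thinSite L y' = thinSite L x' := ⟨x', rfl⟩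
  unfold thinLift
  rw [dif_pos h]
  have hc : h.choose = x' := thinSite_injective hLL h.choose_spec
  rw [hc]

omit [NeZero L'] in
/-- … and is `1` off the image of `ι`. [folklore] -/
theorem thinLift_apply_of_not_exists {d : ℕ} (W : GaugeConfig d L' G) {x : Site d L} (hx : ¬ ∃ x' : Site d L', thinSite L x' = x)
    (i : Fin d) : thinLift L W (x, i) = 1 := by
  unfold thinLift
  rw [dif_neg hx]

/-- A middle site `ι(x') + eᵢ` (when the coarse link `(x', i)` covers two fine links) is not in the image of `ι`. [folklore] -/
theorem not_exists_thinSite_eq_shift (hLL : L' ≤ L) {d : ℕ} {x' : Site d L'} {i : Fin d} (hD : (x' i).val < L - L') :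
    ¬ ∃ y' : Site d L', thinSite L y' = (thinSite L x').shift i := by
  rintro ⟨y', hy⟩
  have h := congrFun hy i
  simp only [thinSite, Site.shift, Pi.add_apply, Pi.single_eq_same] at h
  exact thinCoord_add_one_not_mem_range hLL hD (y' i) h

/-- **Thinning transports left translations**: `thin (thinLift W · U) = W · thin U` (pointwise products of configurations). [folklore] -/
theorem thin_thinLift_mul (hLL : L' ≤ L) {d : ℕ} (W : GaugeConfig d L' G) (U : GaugeConfig d L G) :
    thin L' (thinLift L W * U) = W * thin L' U := by
  funext e'
  obtain ⟨x', i⟩ := e'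
  rw [Pi.mul_apply, thin_apply, thin_apply]
  by_cases hD : (x' i).val < L - L'
  · rw [if_pos hD, if_pos hD, Pi.mul_apply, Pi.mul_apply, thinLift_apply_thinSite hLL,
      thinLift_apply_of_not_exists W (not_exists_thinSite_eq_shift hLL hD), one_mul, mul_assoc]
  · rw [if_neg hD, if_neg hD, Pi.mul_apply, thinLift_apply_thinSite hLL]

end Lift

section Haar

variable {L L' : ℕ} [NeZero L] [NeZero L'] {G : Type*} [Group G] [TopologicalSpace G] [IsTopologicalGroup G] [CompactSpace G]
  [T2Space G] [SecondCountableTopology G] [MeasurableSpace G] [BorelSpace G]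

/-- A left-invariant probability measure on the configuration group `G^{E}` of a torus is the product Haar measure (uniqueness of Haar
measure on the compact group `G^{E}`; Mathlib `isMulLeftInvariant_eq_smul`). [folklore] -/
theorem eq_configMeasure_of_isMulLeftInvariant (ν : Measure (GaugeConfig 3 L' G)) [IsProbabilityMeasure ν] [ν.IsMulLeftInvariant] :
    ν = configMeasure G L' := by
  have hpi : configMeasure G L' = Measure.pi fun _ : Edge 3 L' => haarProbability G := rfl
  rw [hpi]
  have h := Measure.isMulLeftInvariant_eq_smul ν (Measure.pi fun _ : Edge 3 L' => haarProbability G)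
  have h1 : ν Set.univ = 1 := measure_univ
  have h2 : (Measure.pi fun _ : Edge 3 L' => haarProbability G) Set.univ = 1 := measure_univ
  have hc : ν.haarScalarFactor (Measure.pi fun _ : Edge 3 L' => haarProbability G) = 1 := by
    have h3 := congrArg (fun μ : Measure (GaugeConfig 3 L' G) => μ Set.univ) h
    simp only [Measure.smul_apply, h1, h2] at h3
    have h4 : ((ν.haarScalarFactor (Measure.pi fun _ : Edge 3 L' => haarProbability G) : ENNReal)) = 1 := by
      simpa using h3.symm
    exact_mod_cast h4
  rw [h, hc, one_smul]

/-- **`thin_* (∏ Haar) = ∏ Haar`**: the image of the fine a-priori measure under thinning is the coarse a-priori measure — the image is a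
left-invariant probability measure (left translations lift through `thinLift`), hence Haar.  (Equivalently: the coarse links are products of
pairwise disjoint sets of independent Haar-distributed fine links.) Requires `L' ≤ L ≤ 2L'` only through `L' ≤ L`. [folklore] -/
theorem map_thin_configMeasure (hLL : L' ≤ L) :
    (configMeasure G L).map (thin L' : GaugeConfig 3 L G → GaugeConfig 3 L' G) = configMeasure G L' := by
  have hmeas : Measurable (thin L' : GaugeConfig 3 L G → GaugeConfig 3 L' G) := measurable_thin L'
  haveI : IsProbabilityMeasure ((configMeasure G L).map (thin L' : GaugeConfig 3 L G → GaugeConfig 3 L' G)) :=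
    Measure.isProbabilityMeasure_map hmeas.aemeasurable
  haveI : (configMeasure G L).IsMulLeftInvariant := by unfold configMeasure; infer_instance
  haveI : ((configMeasure G L).map (thin L' : GaugeConfig 3 L G → GaugeConfig 3 L' G)).IsMulLeftInvariant := by
    refine ⟨fun W => ?_⟩
    rw [Measure.map_map (measurable_const_mul W) hmeas]
    have hcomp : (fun V : GaugeConfig 3 L' G => W * V) ∘ (thin L' : GaugeConfig 3 L G → GaugeConfig 3 L' G) =
        (thin L' : GaugeConfig 3 L G → GaugeConfig 3 L' G) ∘ fun U => thinLift L W * U := by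
      funext U
      simp only [Function.comp_apply, thin_thinLift_mul hLL]
    rw [hcomp, ← Measure.map_map hmeas (measurable_const_mul _), map_mul_left_eq_self]
  exact eq_configMeasure_of_isMulLeftInvariant _

/-- Thinning is measure preserving between the a-priori measures. [folklore] -/
theorem measurePreserving_thin (hLL : L' ≤ L) :
    MeasurePreserving (thin L' : GaugeConfig 3 L G → GaugeConfig 3 L' G) (configMeasure G L) (configMeasure G L') :=
  ⟨measurable_thin L', map_thin_configMeasure hLL⟩

/-- Change of variables: `∫ F(thin U) dU = ∫ F(V) dV` for measurable `F`. [folklore] -/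
theorem integral_comp_thin (hLL : L' ≤ L) {F : GaugeConfig 3 L' G → ℝ} (hF : Measurable F) :
    ∫ U, F (thin L' U) ∂configMeasure G L = ∫ V, F V ∂configMeasure G L' := by
  have hm : AEMeasurable (thin L' : GaugeConfig 3 L G → GaugeConfig 3 L' G) (configMeasure G L) :=
    (measurable_thin L').aemeasurable
  have h := integral_map hm (f := F) hF.aestronglyMeasurable
  rw [map_thin_configMeasure hLL] at h
  exact h.symm

/-- **The pull-back along thinning is an `L²` isometry**: `⟨ψ ∘ thin, φ ∘ thin⟩_L = ⟨ψ, φ⟩_{L'}` for measurable `ψ`, `φ`. [folklore] -/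
theorem l2_comp_thin (hLL : L' ≤ L) {ψ φ : GaugeConfig 3 L' G → ℝ} (hψ : Measurable ψ) (hφ : Measurable φ) :
    l2 (fun U : GaugeConfig 3 L G => ψ (thin L' U)) (fun U : GaugeConfig 3 L G => φ (thin L' U)) = l2 ψ φ := by
  unfold l2
  exact integral_comp_thin hLL (hψ.mul hφ)

end Haar

section Pullback

variable {L L' : ℕ} [NeZero L] [NeZero L'] {G : Type*} [Group G] [TopologicalSpace G] [IsTopologicalGroup G]
  [SecondCountableTopology G] [MeasurableSpace G] [BorelSpace G]

/-- **The pull-back of a physical zero-flux test function is physical**: bounded measurable, gauge invariant (gauge covariance of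
thinning), zero flux (twist covariance). [cite: Luscher1983] -/
theorem isPhys_comp_thin (hLL : L' ≤ L) (h2 : L ≤ 2 * L') {ψ : GaugeConfig 3 L' G → ℝ} (hψ : IsPhys ψ) :
    IsPhys (fun U : GaugeConfig 3 L G => ψ (thin L' U)) where
  measurable := hψ.measurable.comp (measurable_thin L')
  bounded := by
    obtain ⟨C, hC⟩ := hψ.bounded
    exact ⟨C, fun U => hC _⟩
  gaugeInv := fun g U => by
    show ψ (thin L' (gaugeTransform g U)) = ψ (thin L' U)
    rw [thin_gaugeTransform hLL h2, hψ.gaugeInv]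
  zeroFlux := fun k z hz U => by
    show ψ (thin L' (twist k z U)) = ψ (thin L' U)
    rw [thin_twist hLL, hψ.zeroFlux k z hz]

end Pullback

end Summit.QuantumFields.YangMills.Theorems.FemtoCutoffLadder.Thinning

end
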